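import Literature.NumberTheory.Irrationality.LaiYu2020.ArithmeticFactors
import HarnessLib

/-!
# Lai–Yu 2020, Definition 2.3: the arithmetic factors `A₁(B)`, `A₂(B)`, the period
`P_{B,den(r)}` and the auxiliary rational functions `R_n(t)`

Topic `Literature/NumberTheory/Irrationality/LaiYu2020`. Definitions file accompanying
`NumberOfIrrationalOddZetaValues.lean` (the sets `Ψ_B`, `𝓕_B` of Def. 2.1 live there), for
L. Lai, P. Yu, *A note on the number of irrational odd zeta values*, Compositio Math. **156** (2020)
1699–1717 = arXiv:1911.08458 [LaiYu2020], §2, read on the page (arXiv text p. 4):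

> «Let `r = num(r)/den(r)` be a positive rational number … We refer to `r` the Ball–Rivoal length
> parameter. … We define the integer `P_{B,den(r)} = 2 den(r) · LCM_{b ∈ Ψ_B, p ∣ b} {p − 1}`. …
> **Definition 2.3** (FSZ constructions). For any positive integer `n` which is a multiple of
> `P_{B,den(r)}`, we define the rational function
> `R_n(t) = A₁(B)ⁿ A₂(B)ⁿ · n!^{s+1} / (n/den(r))!^{den(r)(2r+1)|𝓕_B|} ·
>   (t − rn) ∏_{θ ∈ 𝓕_B} ∏_{j=0}^{(2r+1)n−1} (t − rn + j + θ) / ∏_{j=0}^{n} (t+j)^{s+1}`,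
> where `A₁(B) = ∏_{b ∈ Ψ_B} b^{(2r+1)φ(b)}`, we refer to `A₁(B)ⁿ` the major arithmetic (wasting)
> factor, and `A₂(B) = ∏_{b ∈ Ψ_B} ∏_{p ∣ b} p^{(2r+1)φ(b)/(p−1)}`, we refer to `A₂(B)ⁿ` the minor
> arithmetic (wasting) factor. Notice that by (P), both `A₁(B)ⁿ` and `A₂(B)ⁿ` are integers, also,
> `n/den(r)`, `rn`, and `(2r+1)n` are integers.»

Conventions of this file. The length parameter is carried as a pair of naturals `r = u/v`
(`u = num(r)`, `v = den(r)`; coprimality is never needed) and the admissible `n` as `n = v·m`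
(`m = n/den(r)`), so that `rn = u m`, `(2r+1)n = (2u+v) m` and `den(r)(2r+1) = 2u + v` are natural
numbers by construction; the real numbers `A₁(B)`, `A₂(B)` are real powers (`Real.rpow`), and the
integers `A₁(B)ⁿ`, `A₂(B)ⁿ` are the natural numbers `A₁pow`, `A₂pow` (`A₁_pow`, `A₂_pow` identify
them). Beyond the definitions and their unfoldings we PROVE: `(p − 1) ∣ φ(b)` for `p ∣ b` (the
integrality of `A₂(B)ⁿ`), `log A₁(B) = (2r+1) ∑_{Ψ_B} φ(b) log b`,
`log A₂(B) = (2r+1) ∑_{Ψ_B} φ(b) ∑_{p∣b} log p/(p−1)`, and **Lemma 2.4 as printed** for these objects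
(`tendsto_log_A₁_div`: `log A₁(B) / ((2r+1) B² log B) → ½ ζ(2)ζ(3)/ζ(6)`; `A₂_le`:
`A₂(B) ≤ exp(10 (2r+1) B² (log log B)²)` for `B` large), from the sums estimated in
`ArithmeticFactors.lean`. No named facts; sorry-free.

## References

* [LaiYu2020] L. Lai, P. Yu, Compositio Math. 156 (2020) 1699–1717, §2: eq. (P) (definition of
  `P_{B,den(r)}`), Def. 2.3, Lemma 2.4.
-/

noncomputable section

open Filter Topology Finset
open Literature.NumberTheory.Multiplicative.TotientValueCounting

namespace Literature.NumberTheory.Irrationality.LaiYu2020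

/-! ### The period `P_{B,den(r)}` -/

/-- **`P_{B,den(r)} = 2 den(r) · LCM_{b ∈ Ψ_B, p ∣ b} {p − 1}`** (the admissible `n` are its
multiples). Arguments: `B` and `v = den(r)`. [cite: LaiYu2020, §2 eq. (P)] -/
def periodP (B : ℝ) (v : ℕ) : ℕ :=
  2 * v * ((denominatorSet_finite B).toFinset.biUnion Nat.primeFactors).lcm (fun p => p - 1)

/-- Unfolding `P_{B,v}`. [cite: LaiYu2020, §2 eq. (P)] -/
theorem periodP_def (B : ℝ) (v : ℕ) : periodP B v =
    2 * v * ((denominatorSet_finite B).toFinset.biUnion Nat.primeFactors).lcm (fun p => p - 1) := rfl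

/-- `den(r) ∣ P_{B,den(r)}` (so `n/den(r) ∈ ℕ` for admissible `n`). [cite: LaiYu2020, §2 eq. (P)] -/
theorem dvd_periodP (B : ℝ) (v : ℕ) : v ∣ periodP B v :=
  Dvd.intro_left 2 rfl |>.mul_right _

/-- `2 ∣ P_{B,den(r)}` (so `(2r+1)n` is even for admissible `n`). [cite: LaiYu2020, §2 eq. (P)] -/
theorem two_dvd_periodP (B : ℝ) (v : ℕ) : 2 ∣ periodP B v :=
  (Dvd.intro v rfl).mul_right _

/-- `(p − 1) ∣ P_{B,den(r)}` for every prime `p` dividing some `b ∈ Ψ_B`.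
[cite: LaiYu2020, §2 eq. (P)] -/
theorem sub_one_dvd_periodP {B : ℝ} (v : ℕ) {b p : ℕ} (hb : b ∈ denominatorSet B)
    (hp : p ∈ b.primeFactors) : (p - 1) ∣ periodP B v := by
  refine Dvd.dvd.mul_left ?_ _
  exact Finset.dvd_lcm (Finset.mem_biUnion.2 ⟨b, (denominatorSet_finite B).mem_toFinset.2 hb, hp⟩)

/-! ### The arithmetic factors -/

/-- `(p − 1) ∣ φ(b)` for every prime `p ∣ b` (Euler's product formula); this is why `A₂(B)ⁿ` is an
integer as soon as `(2r+1)n` is. [cite: LaiYu2020, §2 Def. 2.3 ("A₂(B)ⁿ [is an] integer")] -/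
theorem sub_one_dvd_totient {b p : ℕ} (hp : p ∈ b.primeFactors) : (p - 1) ∣ Nat.totient b := by
  rw [Nat.totient_eq_div_primeFactors_mul b]
  exact (Finset.dvd_prod_of_mem _ hp).mul_left _

/-- **The major arithmetic factor `A₁(B) = ∏_{b ∈ Ψ_B} b^{(2r+1)φ(b)}`** (a real number; `r` the
Ball–Rivoal length parameter). [cite: LaiYu2020, §2 Def. 2.3] -/
def A₁ (r : ℚ) (B : ℝ) : ℝ :=
  ∏ b ∈ (denominatorSet_finite B).toFinset, (b : ℝ) ^ ((2 * (r : ℝ) + 1) * Nat.totient b)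

/-- **The minor arithmetic factor `A₂(B) = ∏_{b ∈ Ψ_B} ∏_{p ∣ b} p^{(2r+1)φ(b)/(p−1)}`**.
[cite: LaiYu2020, §2 Def. 2.3] -/
def A₂ (r : ℚ) (B : ℝ) : ℝ :=
  ∏ b ∈ (denominatorSet_finite B).toFinset,
    ∏ p ∈ b.primeFactors, (p : ℝ) ^ ((2 * (r : ℝ) + 1) * Nat.totient b / ((p : ℝ) - 1))

/-- Unfolding `A₁`. [cite: LaiYu2020, §2 Def. 2.3] -/
theorem A₁_def (r : ℚ) (B : ℝ) : A₁ r B =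
    ∏ b ∈ (denominatorSet_finite B).toFinset, (b : ℝ) ^ ((2 * (r : ℝ) + 1) * Nat.totient b) := rfl

/-- Unfolding `A₂`. [cite: LaiYu2020, §2 Def. 2.3] -/
theorem A₂_def (r : ℚ) (B : ℝ) : A₂ r B = ∏ b ∈ (denominatorSet_finite B).toFinset,
    ∏ p ∈ b.primeFactors, (p : ℝ) ^ ((2 * (r : ℝ) + 1) * Nat.totient b / ((p : ℝ) - 1)) := rfl

/-- **`A₁(B)ⁿ` as a natural number**, for `r = u/v` and `n = v m`:
`∏_{b ∈ Ψ_B} b^{(2u+v) m φ(b)}` (`(2r+1)n = (2u+v)m`). [cite: LaiYu2020, §2 Def. 2.3] -/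
def A₁pow (u v : ℕ) (B : ℝ) (m : ℕ) : ℕ :=
  ∏ b ∈ (denominatorSet_finite B).toFinset, b ^ ((2 * u + v) * m * Nat.totient b)

/-- **`A₂(B)ⁿ` as a natural number**, for `r = u/v` and `n = v m`:
`∏_{b ∈ Ψ_B} ∏_{p ∣ b} p^{(2u+v) m φ(b)/(p−1)}` (exact division, `sub_one_dvd_totient`).
[cite: LaiYu2020, §2 Def. 2.3] -/
def A₂pow (u v : ℕ) (B : ℝ) (m : ℕ) : ℕ :=
  ∏ b ∈ (denominatorSet_finite B).toFinset,
    ∏ p ∈ b.primeFactors, p ^ ((2 * u + v) * m * Nat.totient b / (p - 1))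

/-- `A₁(B) > 0`. [cite: LaiYu2020, §2 Def. 2.3] -/
theorem A₁_pos (r : ℚ) (B : ℝ) : 0 < A₁ r B := by
  refine prod_pos fun b hb => Real.rpow_pos_of_pos ?_ _
  exact_mod_cast ((denominatorSet_finite B).mem_toFinset.1 hb).1

/-- `A₂(B) > 0`. [cite: LaiYu2020, §2 Def. 2.3] -/
theorem A₂_pos (r : ℚ) (B : ℝ) : 0 < A₂ r B := by
  refine prod_pos fun b _ => prod_pos fun p hp => Real.rpow_pos_of_pos ?_ _
  exact_mod_cast (Nat.prime_of_mem_primeFactors hp).pos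

/-- **`log A₁(B) = (2r+1) ∑_{b ∈ Ψ_B} φ(b) log b`**. [cite: LaiYu2020, Lemma 2.4 (proof, first line)] -/
theorem log_A₁ (r : ℚ) (B : ℝ) : Real.log (A₁ r B) = (2 * (r : ℝ) + 1) *
    ∑ b ∈ (denominatorSet_finite B).toFinset, (Nat.totient b : ℝ) * Real.log b := by
  rw [A₁, Real.log_prod]
  · rw [mul_sum]
    refine sum_congr rfl fun b hb => ?_
    have hb0 : (0 : ℝ) < b := by exact_mod_cast ((denominatorSet_finite B).mem_toFinset.1 hb).1
    rw [Real.log_rpow hb0]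
    ring
  · intro b hb
    have hb0 : (0 : ℝ) < b := by exact_mod_cast ((denominatorSet_finite B).mem_toFinset.1 hb).1
    exact (Real.rpow_pos_of_pos hb0 _).ne'

/-- **`log A₂(B) = (2r+1) ∑_{b ∈ Ψ_B} φ(b) ∑_{p ∣ b} log p/(p−1)`**.
[cite: LaiYu2020, Lemma 2.4 (proof, A₂ part)] -/
theorem log_A₂ (r : ℚ) (B : ℝ) : Real.log (A₂ r B) = (2 * (r : ℝ) + 1) *
    ∑ b ∈ (denominatorSet_finite B).toFinset,
      (Nat.totient b : ℝ) * ∑ p ∈ b.primeFactors, Real.log p / ((p : ℝ) - 1) := by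
  have hpos : ∀ b : ℕ, ∀ p ∈ b.primeFactors,
      0 < (p : ℝ) ^ ((2 * (r : ℝ) + 1) * Nat.totient b / ((p : ℝ) - 1)) := fun b p hp =>
    Real.rpow_pos_of_pos (by exact_mod_cast (Nat.prime_of_mem_primeFactors hp).pos) _
  rw [A₂, Real.log_prod fun b _ => (prod_pos fun p hp => hpos b p hp).ne', mul_sum]
  refine sum_congr rfl fun b _ => ?_
  rw [Real.log_prod fun p hp => (hpos b p hp).ne', mul_sum, mul_sum]
  refine sum_congr rfl fun p hp => ?_
  have hp0 : (0 : ℝ) < p := by exact_mod_cast (Nat.prime_of_mem_primeFactors hp).pos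
  rw [Real.log_rpow hp0]
  ring

/-- `A₁(B)ⁿ = A₁pow` for `r = u/v`, `n = v m` (`v ≥ 1`). [cite: LaiYu2020, §2 Def. 2.3] -/
theorem A₁_pow {u v : ℕ} (hv : 0 < v) (B : ℝ) (m : ℕ) :
    A₁ ((u : ℚ) / v) B ^ (v * m) = (A₁pow u v B m : ℝ) := by
  rw [A₁, A₁pow, ← prod_pow, Nat.cast_prod]
  refine prod_congr rfl fun b hb => ?_
  have hb0 : (0 : ℝ) < b := by exact_mod_cast ((denominatorSet_finite B).mem_toFinset.1 hb).1
  have hv0 : (v : ℝ) ≠ 0 := by exact_mod_cast hv.ne'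
  rw [← Real.rpow_natCast, ← Real.rpow_mul hb0.le, Nat.cast_pow, ← Real.rpow_natCast]
  congr 1
  push_cast
  field_simp

/-- `A₂(B)ⁿ = A₂pow` for `r = u/v`, `n = v m` (`v ≥ 1`). [cite: LaiYu2020, §2 Def. 2.3] -/
theorem A₂_pow {u v : ℕ} (hv : 0 < v) (B : ℝ) (m : ℕ) :
    A₂ ((u : ℚ) / v) B ^ (v * m) = (A₂pow u v B m : ℝ) := by
  rw [A₂, A₂pow, ← prod_pow, Nat.cast_prod]
  refine prod_congr rfl fun b _ => ?_
  rw [← prod_pow, Nat.cast_prod]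
  refine prod_congr rfl fun p hp => ?_
  have hp := Nat.prime_of_mem_primeFactors hp
  have hp0 : (0 : ℝ) < p := by exact_mod_cast hp.pos
  have hp1 : (p : ℝ) - 1 ≠ 0 := by
    have : (2 : ℝ) ≤ p := by exact_mod_cast hp.two_le
    linarith
  have hv0 : (v : ℝ) ≠ 0 := by exact_mod_cast hv.ne'
  have hdvd : (p - 1) ∣ (2 * u + v) * m * Nat.totient b :=
    (sub_one_dvd_totient ‹p ∈ b.primeFactors›).mul_left _
  rw [← Real.rpow_natCast, ← Real.rpow_mul hp0.le, Nat.cast_pow, ← Real.rpow_natCast,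
    Nat.cast_div hdvd (by exact_mod_cast (Nat.sub_ne_zero_of_lt hp.one_lt)),
    Nat.cast_sub hp.one_lt.le]
  congr 1
  push_cast
  field_simp

/-! ### Lemma 2.4 for `A₁(B)`, `A₂(B)` -/

/-- **Lai–Yu 2020, Lemma 2.4 (`A₁`)** (PROVED), for a positive rational `r`:
`A₁(B) = exp((½ ζ(2)ζ(3)/ζ(6) + o(1)) (2r+1) B² log B)`, i.e.
`log A₁(B) / ((2r+1) B² log B) → ½ ζ(2)ζ(3)/ζ(6)` (`density = ζ(2)ζ(3)/ζ(6)`,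
`TotientValueCounting.ofReal_density`). [cite: LaiYu2020, Lemma 2.4] -/
theorem tendsto_log_A₁_div {r : ℚ} (hr : 0 < r) :
    Tendsto (fun B : ℝ => Real.log (A₁ r B) / ((2 * (r : ℝ) + 1) * (B ^ 2 * Real.log B)))
      atTop (𝓝 (density / 2)) := by
  have h2r : (2 * (r : ℝ) + 1) ≠ 0 := by
    have : (0 : ℝ) < r := by exact_mod_cast hr
    linarith
  refine tendsto_sum_totient_log_div.congr fun B => ?_
  rw [log_A₁, mul_div_mul_left _ _ h2r]

/-- **Lai–Yu 2020, Lemma 2.4 (`A₂`)** (PROVED): for a positive rational `r` and every `B` larger than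
some absolute constant, `A₂(B) ≤ exp(10 (2r+1) B² (log log B)²)`. [cite: LaiYu2020, Lemma 2.4] -/
theorem A₂_le {r : ℚ} (hr : 0 < r) :
    ∃ B₀ : ℝ, ∀ B : ℝ, B₀ ≤ B →
      A₂ r B ≤ Real.exp (10 * (2 * (r : ℝ) + 1) * B ^ 2 * Real.log (Real.log B) ^ 2) := by
  obtain ⟨B₀, hB₀⟩ := sum_totient_primeFactors_le
  refine ⟨B₀, fun B hB => ?_⟩
  have h2r : 0 ≤ (2 * (r : ℝ) + 1) := by
    have : (0 : ℝ) < r := by exact_mod_cast hr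
    linarith
  rw [← Real.exp_log (A₂_pos r B), Real.exp_le_exp, log_A₂]
  have := mul_le_mul_of_nonneg_left (hB₀ B hB) h2r
  linarith

/-! ### Definition 2.3: the auxiliary rational functions -/

/-- `𝓕_B` is finite (its elements are the `a/b`, `b ∈ Ψ_B`, `1 ≤ a ≤ b`). [cite: LaiYu2020, Def. 2.1 (2)] -/
theorem zeroSet_finite (B : ℝ) : (zeroSet B).Finite := by
  refine ((denominatorSet_finite B).biUnion fun b _ =>
    (Set.finite_Icc 1 b).image fun a : ℕ => (a : ℚ) / b).subset fun θ hθ => ?_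
  obtain ⟨hpos, hle, hden⟩ := (mem_zeroSet).1 hθ
  refine Set.mem_biUnion hden ⟨θ.num.toNat, ⟨?_, ?_⟩, ?_⟩
  · have := Rat.num_pos.2 hpos
    omega
  · have h := Rat.num_div_den θ
    have hd : (0 : ℚ) < θ.den := by exact_mod_cast θ.pos
    have : (θ.num : ℚ) ≤ θ.den := by
      rw [← h, div_le_one hd] at hle
      exact hle
    have : θ.num ≤ θ.den := by exact_mod_cast this
    omega
  · have hnum : 0 ≤ θ.num := (Rat.num_pos.2 hpos).le
    simp only
    rw [show ((θ.num.toNat : ℕ) : ℚ) = (θ.num : ℚ) by exact_mod_cast Int.toNat_of_nonneg hnum]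
    exact Rat.num_div_den θ

/-- **The Lai–Yu auxiliary rational function `R_n(t)`** (Def. 2.3), for the length parameter
`r = u/v`, `s`, `B` and `n = v m`:
`R_n(t) = A₁(B)ⁿ A₂(B)ⁿ · n!^{s+1} / m!^{(2u+v)|𝓕_B|} ·
  (t − u m) ∏_{θ ∈ 𝓕_B} ∏_{j=0}^{(2u+v)m−1} (t − u m + j + θ) / ∏_{j=0}^{n} (t+j)^{s+1}`
(`rn = um`, `(2r+1)n = (2u+v)m`, `(n/den r)!^{den(r)(2r+1)|𝓕_B|} = m!^{(2u+v)|𝓕_B|}`), as a function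
`ℚ → ℚ` of `t` (value `0` at the poles `t = 0, −1, …, −n`, where the denominator vanishes; `𝓕_B`
enters as the `Finset` of `zeroSet_finite B`, whose cardinality is `|𝓕_B| = (zeroSet B).ncard`,
`ncard_zeroSet_eq_card`). [cite: LaiYu2020, §2 Def. 2.3] -/
def R (u v s : ℕ) (B : ℝ) (m : ℕ) (t : ℚ) : ℚ :=
  (A₁pow u v B m : ℚ) * (A₂pow u v B m : ℚ) * ((v * m).factorial : ℚ) ^ (s + 1) /
      ((m.factorial : ℚ) ^ ((2 * u + v) * (zeroSet_finite B).toFinset.card)) *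
    ((t - u * m) * ∏ θ ∈ (zeroSet_finite B).toFinset,
        ∏ j ∈ range ((2 * u + v) * m), (t - u * m + j + θ)) /
      (∏ j ∈ range (v * m + 1), (t + j)) ^ (s + 1)

/-- `|𝓕_B|` as the cardinality of the `Finset` used in `R`. [cite: LaiYu2020, Def. 2.1 (2)] -/
theorem ncard_zeroSet_eq_card (B : ℝ) : (zeroSet B).ncard = (zeroSet_finite B).toFinset.card :=
  Set.ncard_eq_toFinset_card _ (zeroSet_finite B)

/-- `R_n` vanishes at `t = rn = um` (the factor `t − rn`). [cite: LaiYu2020, §2 Def. 2.3] -/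
theorem R_apply_mul (u v s : ℕ) (B : ℝ) (m : ℕ) : R u v s B m ((u : ℚ) * m) = 0 := by
  simp [R]

end Literature.NumberTheory.Irrationality.LaiYu2020

end
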